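import Summits.QuantumFields.BalabanUV.Beta.EriceRemainderEnclosureHistoryAutonomyComparisonBarrier

/-!
# EriceRemainderEnclosureHistoryAutonomyComparisonBarrierShift — (E61b) THE LEAD IN SCALES NEVER SHRINKS: once the effective β-functions are ordered
# (`B ∘ S ≤ B′ ∘ S′` on ]0,γ]), a perturbed trajectory that has reached the level of the base trajectory `s` scales later stays at least `s` scales
# ahead forever (`lead_mono`, `lead_mono_all`); and when the order is two-sided (`B′ ∘ S′ ≤ B ∘ S + ε`, e.g. comparison for a floor shift) its level
# exceeds the base level `s` scales later by at most the initial offset plus `ε` per scale (`lead_le`, `lead_le_all`) — the INTEGER time shift of the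
# lineage's numerics is monotone although the fractional one is not

Cell `pub-balaban`, β-function sub-cell, BINDER row D4 «RemainderConst leaves for Bałaban's split» (`HOME/BINDER-OWNERS.md`; owner lineage `b2b-balaban-beta-an4`;
this file by co-owner #2 lineage `b2b-balaban-beta-d4-p2`, generation 54), β-FLOW TEAM duty (1), FREEZE (0) honoured (def-free; (E48a)'s `family_mem` ∕
`family_tail_eq` ∕ `strictMonoOn_scale`, (E61a)'s `le_of_invSq_le` BY NAME; nothing restated).  Sequel of (E61a) `…ComparisonBarrier` (the barrier lemma reads
the increments of the perturbed trajectory on the base family; here the same reading is done against the base trajectory SHIFTED IN THE SCALE).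

HONEST FRAMING (page 1, verbatim and binding).  *"Discharging BetaPertH makes Bałaban's UV stability UNCONDITIONAL — a real constructive-QFT result; it is
NOT the continuum limit and NOT the Clay problem."*  THIS FILE DISCHARGES NOTHING OF THE KIND.  Elementary real analysis about ABSTRACT functionals on a box
]0,γ]^ℕ with displayed floors, moduli and signs — hypotheses of a census, not facts; the form, signs and moments of Bałaban's (1.22) limit functional are NOT
PRINTED ([I] p. 298; GAPS G-t4-U2-1∕-2) and NOT asserted.  Row D4 class UNCHANGED (critical-path width 0; instance 0∕1; D4 DISCHARGE NO DATE).  HONEST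
DEPENDENCY: continuum YM on T⁴ ⇐ BetaPertH ∧ nine spine estimates (0/9 proved); BetaPertH ⇐ (D1) ∧ (D4) ∧ CAP+tail; G-an2-4 gates asym, D1 and NE2/3/4.

THE POINT (census sense (α); the COMPARISON column of the autonomy row).  The numerics of `g51/e58` ∕ `g53/e60` describe the perturbed trajectory of an
ordered pair as a TIME SHIFT of the base one, `1∕h′_m² ≈ 1∕h_{m+σ_m}²`, and found the fractional shift `σ_m = δ_m∕v_m` NOT exactly monotone (dips of
relative size `10⁻²…10⁻⁶` right after an excess ends, `g53/e60/README.md` (4)).  Its INTEGER part is monotone, by the one-line mechanism of (E61a): along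
`h′ = S′ y` the increments are `1∕h′_{m+1}² − 1∕h′_m² = B′(S′ h′_{m+1}) ≥ B(S h′_{m+1})` (order at the pin `h′_{m+1}`), and if `h′_{m+1}` were still
above the base point `h_{m+s+1}` this increment would be at least `B(S h_{m+s+1}) = 1∕h_{m+s+1}² − 1∕h_{m+s}²` (pin monotonicity of `B ∘ S`), so a lead of
`s` scales at scale `m` (`1∕h′_m² ≥ 1∕h_{m+s}²`) propagates to scale `m+1` (§1 **`lead_mono`**, **`lead_mono_all`**; `s = 0` is comparison itself).
Symmetrically, when ALSO `B′(S′ z) ≤ B(S z) + ε` (the upper order — automatic for the floor shift `B′ = B + ε` once `S′ ≤ S`), a deficit bound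
`1∕h′_m² ≤ 1∕h_{m+s}² + c` propagates as `1∕h′_{m+1}² ≤ 1∕h_{m+s+1}² + c + ε` (§2 **`lead_le`**, **`lead_le_all`**): the perturbed levels run between the
base levels read `s` scales later and the same plus `ε` per scale — the time-shift bookkeeping that every barrier of (E61a) discretises.  NOT CLAIMED: a
lower bound on the growth of the lead (that is the open quantitative question of (E58′)); anything printed.

WHAT IS PROVED ([folklore]; 0 `def`, 0 sorry).  §1 **`lead_mono`**, **`lead_mono_all`**.  §2 **`lead_le`**, **`lead_le_all`**, `floor_shift_between`.
-/
noncomputable section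
open Finset Set

namespace Summit.QuantumFields.BalabanUV.Beta.EriceRemainderEnclosureHistoryAutonomyComparisonBarrierShift

open Literature.MathematicalPhysics.QuantumFieldTheory.Balaban1983to89
open Literature.MathematicalPhysics.QuantumFieldTheory.Balaban1983to89.T4BetaStationary
open Literature.MathematicalPhysics.QuantumFieldTheory.Balaban1983to89.T4BetaFlowWellPosed
open Summit.QuantumFields.BalabanUV.Beta.EriceRemainderEnclosureHistoryAutonomyOrder
open Summit.QuantumFields.BalabanUV.Beta.EriceRemainderEnclosureHistoryAutonomyComparisonBarrier (le_of_invSq_le)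

variable {B B' : (ℕ → ℝ) → ℝ} {M γ b y ε : ℝ} {S S' : ℝ → ℕ → ℝ}

/-! ## §1 Under the order of the effective β-functions a lead of `s` scales propagates -/

/-- **THE LEAD IN SCALES NEVER SHRINKS.**  `B` ISOTONE with zeroth moment `M ≥ 0` and floor `b > 0` on ]0,γ], unique solution family `S`; `B′` with a
solution family `S′` (unique); the effective β-functions ORDERED at every pin, `B (S z) ≤ B′ (S′ z)`.  If at scale `m` the perturbed trajectory from
`y ∈ ]0,γ]` has reached the base trajectory `s` scales later, `S′ y m ≤ S y (m+s)`, then so it has at scale `m+1`: `S′ y (m+1) ≤ S y (m+s+1)`.  (The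
increment `1∕(S′ y (m+1))² − 1∕(S′ y m)² = B′(S′(S′ y (m+1))) ≥ B(S(S′ y (m+1)))`; were `S′ y (m+1) > S y (m+s+1)`, this would be at least
`B(S(S y (m+s+1))) = 1∕(S y (m+s+1))² − 1∕(S y (m+s))²`.) [folklore] -/
theorem lead_mono
    (hmono : ∀ u v : ℕ → ℝ, SeqBox γ u → SeqBox γ v → (∀ j, u j ≤ v j) → B u ≤ B v) (hγ : 0 < γ) (hb : 0 < b)
    (hB : ∀ u u' : ℕ → ℝ, SeqBox γ u → SeqBox γ u' → ∀ D : ℝ, (∀ j, |u j - u' j| ≤ D) → |B u - B u'| ≤ M * D)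
    (hM : 0 ≤ M) (hlo : ∀ u, SeqBox γ u → b ≤ B u)
    (hS : ∀ p, 0 < p → p ≤ γ → SeqBox γ (S p) ∧ MemFlow B p (S p))
    (huniq : ∀ p, 0 < p → p ≤ γ → ∀ u u' : ℕ → ℝ, SeqBox γ u → SeqBox γ u' → MemFlow B p u → MemFlow B p u' → u = u')
    (hS' : ∀ p, 0 < p → p ≤ γ → SeqBox γ (S' p) ∧ MemFlow B' p (S' p))
    (huniq' : ∀ p, 0 < p → p ≤ γ → ∀ u u' : ℕ → ℝ, SeqBox γ u → SeqBox γ u' → MemFlow B' p u → MemFlow B' p u' → u = u')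
    (horder : ∀ z, 0 < z → z ≤ γ → B (S z) ≤ B' (S' z))
    (hy : 0 < y) (hyγ : y ≤ γ) {m s : ℕ} (hlead : S' y m ≤ S y (m + s)) : S' y (m + 1) ≤ S y (m + s + 1) := by
  by_contra hlt
  rw [not_le] at hlt
  have hz := family_mem hS' hy hyγ (m + 1)
  have hw := family_mem hS hy hyγ (m + s + 1)
  -- the increment of S′ y at scale m, bounded below through the order at the pin S′ y (m+1)
  have hflow' : 1 / S' y (m + 1) ^ 2 = 1 / S' y m ^ 2 + B' (S' (S' y (m + 1))) := by
    rw [← family_tail_eq hS' huniq' hy hyγ (m + 1)]; exact (hS' y hy hyγ).2.2 m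
  have hflow : 1 / S y (m + s + 1) ^ 2 = 1 / S y (m + s) ^ 2 + B (S (S y (m + s + 1))) := by
    rw [← family_tail_eq hS huniq hy hyγ (m + s + 1)]; exact (hS y hy hyγ).2.2 (m + s)
  have h1 : B (S (S' y (m + 1))) ≤ B' (S' (S' y (m + 1))) := horder _ hz.1 hz.2
  have h2 : B (S (S y (m + s + 1))) ≤ B (S (S' y (m + 1))) :=
    hmono _ _ (hS _ hw.1 hw.2).1 (hS _ hz.1 hz.2).1 fun j => (strictMonoOn_scale hb hγ hB hM hlo hS huniq j).monotoneOn hw hz hlt.le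
  have h3 : 1 / S y (m + s) ^ 2 ≤ 1 / S' y m ^ 2 :=
    one_div_le_one_div_of_le (pow_pos (family_mem hS' hy hyγ m).1 2) (pow_le_pow_left₀ (family_mem hS' hy hyγ m).1.le hlead 2)
  have h4 : 1 / S y (m + s + 1) ^ 2 ≤ 1 / S' y (m + 1) ^ 2 := by rw [hflow, hflow']; linarith
  exact absurd (le_of_invSq_le hw.1 h4) (not_le.mpr hlt)

/-- … hence at EVERY later scale: `S′ y m ≤ S y (m+s)` gives `S′ y n ≤ S y (n+s)` for all `n ≥ m` — once `s` scales ahead, always at least `s` scales ahead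
(`s = 0`, `m = 0`: comparison from the pin). [folklore] -/
theorem lead_mono_all
    (hmono : ∀ u v : ℕ → ℝ, SeqBox γ u → SeqBox γ v → (∀ j, u j ≤ v j) → B u ≤ B v) (hγ : 0 < γ) (hb : 0 < b)
    (hB : ∀ u u' : ℕ → ℝ, SeqBox γ u → SeqBox γ u' → ∀ D : ℝ, (∀ j, |u j - u' j| ≤ D) → |B u - B u'| ≤ M * D)
    (hM : 0 ≤ M) (hlo : ∀ u, SeqBox γ u → b ≤ B u)
    (hS : ∀ p, 0 < p → p ≤ γ → SeqBox γ (S p) ∧ MemFlow B p (S p))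
    (huniq : ∀ p, 0 < p → p ≤ γ → ∀ u u' : ℕ → ℝ, SeqBox γ u → SeqBox γ u' → MemFlow B p u → MemFlow B p u' → u = u')
    (hS' : ∀ p, 0 < p → p ≤ γ → SeqBox γ (S' p) ∧ MemFlow B' p (S' p))
    (huniq' : ∀ p, 0 < p → p ≤ γ → ∀ u u' : ℕ → ℝ, SeqBox γ u → SeqBox γ u' → MemFlow B' p u → MemFlow B' p u' → u = u')
    (horder : ∀ z, 0 < z → z ≤ γ → B (S z) ≤ B' (S' z))
    (hy : 0 < y) (hyγ : y ≤ γ) {m s : ℕ} (hlead : S' y m ≤ S y (m + s)) {n : ℕ} (hn : m ≤ n) : S' y n ≤ S y (n + s) := by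
  induction n, hn using Nat.le_induction with
  | base => exact hlead
  | succ n _ ih =>
    rw [show n + 1 + s = n + s + 1 by omega]
    exact lead_mono hmono hγ hb hB hM hlo hS huniq hS' huniq' horder hy hyγ ih

/-! ## §2 Under the two-sided order the lead grows by at most `ε` per scale -/

/-- **THE LEAD GROWS BY AT MOST `ε` PER SCALE.**  Same base data; `B′` with a unique solution family `S′` and the UPPER order `B′ (S′ z) ≤ B (S z) + ε` at
every pin (`ε ≥ 0`; for the floor shift `B′ = B + ε` this is comparison `S′ ≤ S`).  If at scale `m` the perturbed level exceeds the base level `s` scales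
later by at most `c ≥ 0`, `1∕(S′ y m)² ≤ 1∕(S y (m+s))² + c`, then at scale `m+1` by at most `c + ε`: `1∕(S′ y (m+1))² ≤ 1∕(S y (m+s+1))² + c + ε`.
(Either `S′ y (m+1) ≥ S y (m+s+1)` outright, or the increment `B′(S′(S′ y (m+1))) ≤ B(S(S′ y (m+1))) + ε ≤ B(S(S y (m+s+1))) + ε`.) [folklore] -/
theorem lead_le
    (hmono : ∀ u v : ℕ → ℝ, SeqBox γ u → SeqBox γ v → (∀ j, u j ≤ v j) → B u ≤ B v) (hγ : 0 < γ) (hb : 0 < b)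
    (hB : ∀ u u' : ℕ → ℝ, SeqBox γ u → SeqBox γ u' → ∀ D : ℝ, (∀ j, |u j - u' j| ≤ D) → |B u - B u'| ≤ M * D)
    (hM : 0 ≤ M) (hlo : ∀ u, SeqBox γ u → b ≤ B u)
    (hS : ∀ p, 0 < p → p ≤ γ → SeqBox γ (S p) ∧ MemFlow B p (S p))
    (huniq : ∀ p, 0 < p → p ≤ γ → ∀ u u' : ℕ → ℝ, SeqBox γ u → SeqBox γ u' → MemFlow B p u → MemFlow B p u' → u = u')
    (hS' : ∀ p, 0 < p → p ≤ γ → SeqBox γ (S' p) ∧ MemFlow B' p (S' p))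
    (huniq' : ∀ p, 0 < p → p ≤ γ → ∀ u u' : ℕ → ℝ, SeqBox γ u → SeqBox γ u' → MemFlow B' p u → MemFlow B' p u' → u = u')
    (hε : 0 ≤ ε) (hupper : ∀ z, 0 < z → z ≤ γ → B' (S' z) ≤ B (S z) + ε)
    (hy : 0 < y) (hyγ : y ≤ γ) {m s : ℕ} {c : ℝ} (hc : 0 ≤ c) (hdef : 1 / S' y m ^ 2 ≤ 1 / S y (m + s) ^ 2 + c) :
    1 / S' y (m + 1) ^ 2 ≤ 1 / S y (m + s + 1) ^ 2 + c + ε := by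
  have hz := family_mem hS' hy hyγ (m + 1)
  have hw := family_mem hS hy hyγ (m + s + 1)
  rcases le_or_gt (S y (m + s + 1)) (S' y (m + 1)) with hge | hlt
  · -- the perturbed trajectory is not beyond the shifted base point: its level is at most that level
    have : 1 / S' y (m + 1) ^ 2 ≤ 1 / S y (m + s + 1) ^ 2 :=
      one_div_le_one_div_of_le (pow_pos hw.1 2) (pow_le_pow_left₀ hw.1.le hge 2)
    linarith
  · have hflow' : 1 / S' y (m + 1) ^ 2 = 1 / S' y m ^ 2 + B' (S' (S' y (m + 1))) := by
      rw [← family_tail_eq hS' huniq' hy hyγ (m + 1)]; exact (hS' y hy hyγ).2.2 m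
    have hflow : 1 / S y (m + s + 1) ^ 2 = 1 / S y (m + s) ^ 2 + B (S (S y (m + s + 1))) := by
      rw [← family_tail_eq hS huniq hy hyγ (m + s + 1)]; exact (hS y hy hyγ).2.2 (m + s)
    have h1 : B' (S' (S' y (m + 1))) ≤ B (S (S' y (m + 1))) + ε := hupper _ hz.1 hz.2
    have h2 : B (S (S' y (m + 1))) ≤ B (S (S y (m + s + 1))) :=
      hmono _ _ (hS _ hz.1 hz.2).1 (hS _ hw.1 hw.2).1 fun j => (strictMonoOn_scale hb hγ hB hM hlo hS huniq j).monotoneOn hz hw hlt.le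
    rw [hflow', hflow]
    linarith

/-- … hence at every later scale: `1∕(S′ y m)² ≤ 1∕(S y (m+s))² + c` gives `1∕(S′ y n)² ≤ 1∕(S y (n+s))² + c + (n − m)·ε` for all `n ≥ m`. [folklore] -/
theorem lead_le_all
    (hmono : ∀ u v : ℕ → ℝ, SeqBox γ u → SeqBox γ v → (∀ j, u j ≤ v j) → B u ≤ B v) (hγ : 0 < γ) (hb : 0 < b)
    (hB : ∀ u u' : ℕ → ℝ, SeqBox γ u → SeqBox γ u' → ∀ D : ℝ, (∀ j, |u j - u' j| ≤ D) → |B u - B u'| ≤ M * D)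
    (hM : 0 ≤ M) (hlo : ∀ u, SeqBox γ u → b ≤ B u)
    (hS : ∀ p, 0 < p → p ≤ γ → SeqBox γ (S p) ∧ MemFlow B p (S p))
    (huniq : ∀ p, 0 < p → p ≤ γ → ∀ u u' : ℕ → ℝ, SeqBox γ u → SeqBox γ u' → MemFlow B p u → MemFlow B p u' → u = u')
    (hS' : ∀ p, 0 < p → p ≤ γ → SeqBox γ (S' p) ∧ MemFlow B' p (S' p))
    (huniq' : ∀ p, 0 < p → p ≤ γ → ∀ u u' : ℕ → ℝ, SeqBox γ u → SeqBox γ u' → MemFlow B' p u → MemFlow B' p u' → u = u')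
    (hε : 0 ≤ ε) (hupper : ∀ z, 0 < z → z ≤ γ → B' (S' z) ≤ B (S z) + ε)
    (hy : 0 < y) (hyγ : y ≤ γ) {m s : ℕ} {c : ℝ} (hc : 0 ≤ c) (hdef : 1 / S' y m ^ 2 ≤ 1 / S y (m + s) ^ 2 + c) {n : ℕ} (hn : m ≤ n) :
    1 / S' y n ^ 2 ≤ 1 / S y (n + s) ^ 2 + c + ((n : ℝ) - m) * ε := by
  induction n, hn using Nat.le_induction with
  | base => simpa using hdef
  | succ n hmn ih =>
    have hc' : 0 ≤ c + ((n : ℝ) - m) * ε := by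
      have : (m : ℝ) ≤ n := by exact_mod_cast hmn
      nlinarith
    have ih' : 1 / S' y n ^ 2 ≤ 1 / S y (n + s) ^ 2 + (c + ((n : ℝ) - m) * ε) := by linarith
    have := lead_le hmono hγ hb hB hM hlo hS huniq hS' huniq' hε hupper hy hyγ hc' ih'
    rw [Nat.cast_succ, show n + 1 + s = n + s + 1 by omega]
    linarith

/-- **THE PERTURBED LEVELS OF AN ORDERED FLOOR SHIFT RUN BETWEEN SHIFTED BASE LEVELS.**  Base data as above, `B′ = B + ε` (`ε ≥ 0`) with a unique solution
family `S′`, the effective β-functions ordered (`B (S z) ≤ B (S′ z) + ε` at every pin — the conclusion of (E61a) `effective_le_all_of_delay` or of any END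
of the column) and the families comparing (`S′ ≤ S`).  Then along every trajectory from `y ∈ ]0,γ]`, for every lead `s` acquired at a scale `m`
(`S′ y m ≤ S y (m+s)`): `1∕(S y (n+s))² ≤ 1∕(S′ y n)² ≤ 1∕(S y (n+s))² + (1∕(S′ y m)² − 1∕(S y (m+s))²) + (n − m)·ε` for all `n ≥ m`. [folklore] -/
theorem floor_shift_between
    (hmono : ∀ u v : ℕ → ℝ, SeqBox γ u → SeqBox γ v → (∀ j, u j ≤ v j) → B u ≤ B v) (hγ : 0 < γ) (hb : 0 < b)
    (hB : ∀ u u' : ℕ → ℝ, SeqBox γ u → SeqBox γ u' → ∀ D : ℝ, (∀ j, |u j - u' j| ≤ D) → |B u - B u'| ≤ M * D)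
    (hM : 0 ≤ M) (hlo : ∀ u, SeqBox γ u → b ≤ B u) (hε : 0 ≤ ε)
    (hS : ∀ p, 0 < p → p ≤ γ → SeqBox γ (S p) ∧ MemFlow B p (S p))
    (huniq : ∀ p, 0 < p → p ≤ γ → ∀ u u' : ℕ → ℝ, SeqBox γ u → SeqBox γ u' → MemFlow B p u → MemFlow B p u' → u = u')
    (hS' : ∀ p, 0 < p → p ≤ γ → SeqBox γ (S' p) ∧ MemFlow (fun u => B u + ε) p (S' p))
    (huniq' : ∀ p, 0 < p → p ≤ γ → ∀ u u' : ℕ → ℝ, SeqBox γ u → SeqBox γ u' →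
      MemFlow (fun u => B u + ε) p u → MemFlow (fun u => B u + ε) p u' → u = u')
    (horder : ∀ z, 0 < z → z ≤ γ → B (S z) ≤ B (S' z) + ε) (hcomp : ∀ z, 0 < z → z ≤ γ → ∀ j, S' z j ≤ S z j)
    (hy : 0 < y) (hyγ : y ≤ γ) {m s : ℕ} (hlead : S' y m ≤ S y (m + s)) {n : ℕ} (hn : m ≤ n) :
    1 / S y (n + s) ^ 2 ≤ 1 / S' y n ^ 2 ∧
      1 / S' y n ^ 2 ≤ 1 / S y (n + s) ^ 2 + (1 / S' y m ^ 2 - 1 / S y (m + s) ^ 2) + ((n : ℝ) - m) * ε := by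
  have horder' : ∀ z, 0 < z → z ≤ γ → B (S z) ≤ (fun u => B u + ε) (S' z) := fun z hz hzγ => by simpa using horder z hz hzγ
  have hupper : ∀ z, 0 < z → z ≤ γ → (fun u => B u + ε) (S' z) ≤ B (S z) + ε := fun z hz hzγ => by
    simpa using hmono _ _ (hS' z hz hzγ).1 (hS z hz hzγ).1 (hcomp z hz hzγ)
  have hlow := lead_mono_all hmono hγ hb hB hM hlo hS huniq hS' huniq' horder' hy hyγ hlead hn
  refine ⟨one_div_le_one_div_of_le (pow_pos (family_mem hS' hy hyγ n).1 2) (pow_le_pow_left₀ (family_mem hS' hy hyγ n).1.le hlow 2), ?_⟩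
  have hc : 0 ≤ 1 / S' y m ^ 2 - 1 / S y (m + s) ^ 2 :=
    sub_nonneg.mpr (one_div_le_one_div_of_le (pow_pos (family_mem hS' hy hyγ m).1 2)
      (pow_le_pow_left₀ (family_mem hS' hy hyγ m).1.le hlead 2))
  have := lead_le_all hmono hγ hb hB hM hlo hS huniq hS' huniq' hε hupper hy hyγ hc (by linarith) hn
  linarith

end Summit.QuantumFields.BalabanUV.Beta.EriceRemainderEnclosureHistoryAutonomyComparisonBarrierShift

end
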